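import Mathlib
import Summits.ValiantsHypothesis.ValiantsHypothesis.Theorems.KPlusLogSqLawTropicalBSingleGauge
import Summits.ValiantsHypothesis.ValiantsHypothesis.Theorems.KPlusLogSqLawTropicalBNoRepeatedExchange

/-!
# Route «KPlusLogSqLaw», crux `TropicalB` (stmt-ValiantsHypothesis-19771) — RUNS AND RETURNS: a dominant chain is paid for in COLUMN CHANGES,
# changes = (new incidences) + (RETURNS), and the RETURN-FREE sector satisfies the inequality of `TropicalB` with `C = 3`

HONEST FRAMING.  Helper file (cell `pub-symmetroid`, seat val-sym-trop-p1 g22, 2026-08-29) `--supports` the crux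
`Summit.ValiantsHypothesis.ValiantsHypothesis.Theses.KPlusLogSqLaw.TropicalB` (item `stmt-ValiantsHypothesis-19771`, registered stubs
`stub_tropThin` / `stub_tropFat` of `Cruxes/TropicalB/Lines/birth.lean`).  Elementary ACCOUNTING for dominant chains of ARBITRARY designs, plus
one SECTOR statement (return-free chains); nothing here bounds `TropicalB` for general designs and nothing bears on `WeakLifting`, DoorA26 / DoorA34,
`MatrixDescartes` (stmt-ValiantsHypothesis-18050) or VP ≠ VNP.

VOCABULARY (inline, no definitions).  Along a chain `p₀, …, pₙ` the INCIDENCE of column `j` at time `k` is `(σₖ j, λₖ j)` (row, class).  A CHANGE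
of column `j` is a step `k → k+1` at which its incidence changes; a RETURN of column `j` is a change into an incidence the column has ALREADY used
(so `#changes_j + 1 = #runs_j = #distinct incidences_j + #returns_j`); a column is RETURN-FREE iff its incidence sequence has the interval
property of `SingleGauge.card_steps_le`.

CONTENT.
* `le_sum_card_changes` — **RUNS LAW** (pure combinatorics): if consecutive tuples differ, `n ≤ Σ_j #changes_j`.
* `card_image_le_card_changes_succ` — every column has `#distinct values ≤ #changes + 1` (so the number of returns is a natural number);
  `card_changes_succ_le_card_image_of_interval` — a return-free column has `#changes + 1 ≤ #distinct values` (hence equality).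
* `chain_le_sum_card_changes` — for a sign-alternating dominant chain (hypotheses of `TropRootLawAt`): `n ≤ Σ_j #changes_j`, and
  `card_image_le_card_present` — the distinct incidences of a column are among its PRESENT incidences.
* `chain_le_of_returnFree` — **RETURN-FREE SECTOR**: if no column returns, `n + m ≤ #present incidences` (`≤ m·(m·K)`, `sum_card_present_le`);
  `tropicalB_shape_of_returnFree` — hence `n ≤ 2^(3(K + ⌊log₂ m⌋²))`, the inequality of `TropicalB` with `C = 3`, for every return-free chain;
  `chain_le_present_add_returns` — in general `n + m ≤ #present incidences + R`, `R = Σ_j (#changes_j + 1 − #distinct incidences_j)` the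
  number of returns: every step beyond the return-free budget is a return.
READING (located, seat memo DUAL-LANE-g22 §7, not claimed): the counting-tight `(5,4)` chain of the tree has 131 returns for 56 terms and 62 present
incidences — long chains are bought with RETURNS, and by the runs law a chain violating `TropicalB` must return to old incidences more than
`2^{C(K + log² m)} − m²K` times; the single-gauge families of the cell (SHIFT-THREE, DIAMOND) are return-free.  [this seat; `card_steps_le` is the
tree's (val-sym-trop-p5 g10)]
-/

set_option linter.dupNamespace false
set_option autoImplicit false

namespace Summit.ValiantsHypothesis.ValiantsHypothesis.Theorems.KPlusLogSqLaw

open Summit.ValiantsHypothesis.ValiantsHypothesis.Theorems.MatrixDescartes.Negative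
open Summit.ValiantsHypothesis.ValiantsHypothesis.Theorems.LacunarySymmetroidMatrixDescartes
open Summit.ValiantsHypothesis.ValiantsHypothesis.Theorems.LacunarySymmetroidMatrixDescartes.TropicalCensus
open Finset

namespace Returns

/-! ## 1. Pure combinatorics of changes, values and returns -/

section Combinatorics

variable {X : Type*} [DecidableEq X] {m n : ℕ}

/-- **RUNS LAW.**  If consecutive tuples of the `m` sequences differ somewhere, the number of steps is at most the total number of column
changes: `n ≤ Σ_j #{k : column j changes at step k}`. [folklore] -/
theorem le_sum_card_changes (c : Fin m → Fin (n + 1) → X)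
    (hstep : ∀ k : Fin n, ∃ j, c j k.castSucc ≠ c j k.succ) :
    n ≤ ∑ j : Fin m, (univ.filter fun k : Fin n => c j k.castSucc ≠ c j k.succ).card := by
  classical
  have hcover : (univ : Finset (Fin n)) ⊆ univ.biUnion fun j => univ.filter fun k : Fin n => c j k.castSucc ≠ c j k.succ := by
    intro k _
    obtain ⟨j, hj⟩ := hstep k
    exact mem_biUnion.mpr ⟨j, mem_univ _, mem_filter.mpr ⟨mem_univ _, hj⟩⟩
  calc n = (univ : Finset (Fin n)).card := by rw [card_univ, Fintype.card_fin]
    _ ≤ (univ.biUnion fun j => univ.filter fun k : Fin n => c j k.castSucc ≠ c j k.succ).card := card_le_card hcover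
    _ ≤ ∑ j, (univ.filter fun k : Fin n => c j k.castSucc ≠ c j k.succ).card := card_biUnion_le

/-- **values ≤ changes + 1**: every value of a sequence other than its initial one is entered at some change, and distinct values are
entered at distinct (last-entry) steps; so `#returns = #changes + 1 − #values` is a natural number. [folklore] -/
theorem card_image_le_card_changes_succ (f : Fin (n + 1) → X) :
    (univ.image f).card ≤ (univ.filter fun k : Fin n => f k.castSucc ≠ f k.succ).card + 1 := by
  classical
  -- map each value `x ≠ f 0` to the LAST step entering `x`... simpler: to the step just before its FIRST occurrence
  let first : X → Finset (Fin (n + 1)) := fun x => univ.filter fun k => f k = x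
  have hne : ∀ x ∈ univ.image f, (first x).Nonempty := by
    intro x hx
    obtain ⟨k, _, hk⟩ := mem_image.mp hx
    exact ⟨k, mem_filter.mpr ⟨mem_univ _, hk⟩⟩
  -- the first occurrence time of a value
  let t : X → Fin (n + 1) := fun x => if hx : x ∈ univ.image f then (first x).min' (hne x hx) else 0
  have ht_val : ∀ x ∈ univ.image f, f (t x) = x := by
    intro x hx
    have := min'_mem (first x) (hne x hx)
    simp only [t, dif_pos hx]
    exact (mem_filter.mp this).2
  have ht_min : ∀ x ∈ univ.image f, ∀ k, f k = x → t x ≤ k := by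
    intro x hx k hk
    simp only [t, dif_pos hx]
    exact Finset.min'_le (first x) k (mem_filter.mpr ⟨mem_univ _, hk⟩)
  -- every value other than `f 0` is entered at a change: `x = f (k+1)` with `k+1` its first occurrence
  set S := (univ.image f).erase (f 0) with hS_def
  set C := univ.filter fun k : Fin n => f k.castSucc ≠ f k.succ with hC_def
  have hcov : S ⊆ C.image fun k => f k.succ := by
    intro x hx
    have hx' := mem_of_mem_erase hx
    have hx0 : x ≠ f 0 := (mem_erase.mp hx).1
    have ht0 : t x ≠ 0 := by
      intro h
      apply hx0
      rw [← ht_val x hx', h]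
    obtain ⟨k, hk⟩ := Fin.exists_succ_eq.mpr ht0
    refine mem_image.mpr ⟨k, ?_, by rw [hk, ht_val x hx']⟩
    rw [hC_def, mem_filter]
    refine ⟨mem_univ _, fun heq => ?_⟩
    -- `f k.castSucc = f (t x) = x` with `k.castSucc < t x`: contradicts minimality
    rw [hk, ht_val x hx'] at heq
    have hle := ht_min x hx' _ heq
    rw [← hk, Fin.le_def] at hle
    simp only [Fin.val_succ, Fin.val_castSucc] at hle
    omega
  have hcard : S.card ≤ C.card := (card_le_card hcov).trans card_image_le
  have h0 : f 0 ∈ univ.image f := mem_image_of_mem _ (mem_univ _)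
  have := card_erase_of_mem h0
  rw [← hS_def] at this
  omega

/-- **a return-free column has changes + 1 ≤ values**: under the interval property every change enters a value never seen before in that
column, so changes inject into the non-initial values. [folklore] -/
theorem card_changes_succ_le_card_image_of_interval (f : Fin (n + 1) → X)
    (hint : ∀ k₁ k₂ k₃ : Fin (n + 1), k₁ < k₂ → k₂ < k₃ → f k₁ = f k₃ → f k₂ = f k₁) :
    (univ.filter fun k : Fin n => f k.castSucc ≠ f k.succ).card + 1 ≤ (univ.image f).card := by
  classical
  -- changes inject into values ≠ f 0 via k ↦ f (k+1)
  set C := univ.filter fun k : Fin n => f k.castSucc ≠ f k.succ with hC_def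
  have hmap : ∀ k ∈ C, f k.succ ∈ (univ.image f).erase (f 0) := by
    intro k hk
    have hk' := (mem_filter.mp hk).2
    refine mem_erase.mpr ⟨?_, mem_image_of_mem _ (mem_univ _)⟩
    intro heq
    -- f 0 = f (k+1) with 0 ≤ k < k+1: if 0 < castSucc k use the interval property at k.castSucc; if k = 0 direct
    rcases eq_or_lt_of_le (Fin.zero_le k.castSucc) with h0 | h0
    · apply hk'; rw [← h0, heq]
    · have := hint 0 k.castSucc k.succ h0 Fin.castSucc_lt_succ heq.symm
      apply hk'; rw [this, heq]
  have hinj : Set.InjOn (fun k : Fin n => f k.succ) C := by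
    intro k hk k' hk' hkk'
    simp only at hkk'
    by_contra hne
    rcases lt_or_gt_of_ne hne with hlt | hlt
    · -- k < k': f (k+1) = f (k'+1), so by the interval property f k'.castSucc = f (k+1) = f (k'+1): no change at k'
      have h1 : k.succ < k'.succ := Fin.succ_lt_succ_iff.mpr hlt
      rcases eq_or_lt_of_le (show k.succ ≤ k'.castSucc from by
          rw [Fin.le_def]; simp only [Fin.val_succ, Fin.val_castSucc]; exact hlt) with h2 | h2
      · exact (mem_filter.mp hk').2 (by rw [← h2, hkk'])
      · have := hint k.succ k'.castSucc k'.succ h2 Fin.castSucc_lt_succ hkk'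
        exact (mem_filter.mp hk').2 (by rw [this, hkk'])
    · have h1 : k'.succ < k.succ := Fin.succ_lt_succ_iff.mpr hlt
      rcases eq_or_lt_of_le (show k'.succ ≤ k.castSucc from by
          rw [Fin.le_def]; simp only [Fin.val_succ, Fin.val_castSucc]; exact hlt) with h2 | h2
      · exact (mem_filter.mp hk).2 (by rw [← h2, ← hkk'])
      · have := hint k'.succ k.castSucc k.succ h2 Fin.castSucc_lt_succ hkk'.symm
        exact (mem_filter.mp hk).2 (by rw [this, ← hkk'])
  have hcard := card_le_card_of_injOn _ hmap hinj
  have h0 : f 0 ∈ univ.image f := mem_image_of_mem _ (mem_univ _)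
  have := card_erase_of_mem h0
  have hpos : 0 < (univ.image f).card := card_pos.mpr ⟨f 0, h0⟩
  omega

end Combinatorics

/-! ## 2. Dominant chains -/

section Chain

variable {m K n : ℕ} (d : Fin K → ℕ) (v ε : Fin m → Fin m → Fin K → ℤ) (θ : Fin (n + 1) → ℤ)
  (p : Fin (n + 1) → Equiv.Perm (Fin m) × (Fin m → Fin K))

/-- consecutive terms of a sign-alternating chain are distinct. [folklore] -/
theorem ne_succ_of_alt (halt : ∀ k : Fin n, termSign ε (p k.castSucc) * termSign ε (p k.succ) < 0) (k : Fin n) :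
    p k.castSucc ≠ p k.succ := by
  intro h
  have := halt k
  rw [h] at this
  exact absurd this (not_lt.mpr (mul_self_nonneg _))

/-- **RUNS LAW for chains**: along a sign-alternating chain the number of steps is at most the total number of column changes (a change of
column `j` at step `k`: its incidence `(σ j, λ j)` differs at `k` and `k+1`). [this seat] -/
theorem chain_le_sum_card_changes (halt : ∀ k : Fin n, termSign ε (p k.castSucc) * termSign ε (p k.succ) < 0) :
    n ≤ ∑ j : Fin m, (univ.filter fun k : Fin n =>
      ((p k.castSucc).1 j, (p k.castSucc).2 j) ≠ ((p k.succ).1 j, (p k.succ).2 j)).card := by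
  classical
  refine le_sum_card_changes (fun j k => ((p k).1 j, (p k).2 j)) fun k => ?_
  by_contra hcon
  push Not at hcon
  apply ne_succ_of_alt ε p halt k
  have e1 : (p k.castSucc).1 = (p k.succ).1 := Equiv.ext fun j => (Prod.mk.inj (hcon j)).1
  have e2 : (p k.castSucc).2 = (p k.succ).2 := funext fun j => (Prod.mk.inj (hcon j)).2
  exact Prod.ext e1 e2

/-- the incidences used by a column along a chain of PRESENT terms are present incidences of that column. [folklore] -/
theorem card_image_le_card_present (hdom : ∀ k, IsDominant d v ε (θ k) (p k)) (j : Fin m) :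
    (univ.image fun k : Fin (n + 1) => ((p k).1 j, (p k).2 j)).card ≤
      (univ.filter fun al : Fin m × Fin K => ε al.1 j al.2 ≠ 0).card := by
  classical
  refine card_le_card fun al hal => ?_
  obtain ⟨k, _, hk⟩ := mem_image.mp hal
  rw [mem_filter]
  refine ⟨mem_univ _, ?_⟩
  rw [← hk]
  exact present_of_termSign_ne_zero ε (p k) (hdom k).1 j

/-- **RETURN-FREE SECTOR.**  If no column of a sign-alternating dominant chain at strictly increasing slopes returns to an incidence it has
left (interval property in every column), then `n + m ≤ #present incidences` (summed over columns). [this seat; the counting step is the tree's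
`SingleGauge.card_steps_le`, injectivity of the chain is `NoRepeatedExchange.chain_injective`] -/
theorem chain_le_of_returnFree (hθ : StrictMono θ) (hdom : ∀ k, IsDominant d v ε (θ k) (p k))
    (halt : ∀ k : Fin n, termSign ε (p k.castSucc) * termSign ε (p k.succ) < 0)
    (hrf : ∀ (j : Fin m) (k₁ k₂ k₃ : Fin (n + 1)), k₁ < k₂ → k₂ < k₃ →
      ((p k₁).1 j, (p k₁).2 j) = ((p k₃).1 j, (p k₃).2 j) → ((p k₂).1 j, (p k₂).2 j) = ((p k₁).1 j, (p k₁).2 j)) :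
    n + m ≤ ∑ j : Fin m, (univ.filter fun al : Fin m × Fin K => ε al.1 j al.2 ≠ 0).card := by
  classical
  have hinj := NoRepeatedExchange.chain_injective d v ε hθ hdom halt
  have hdist : ∀ k k' : Fin (n + 1), k ≠ k' → ∃ j, ((p k).1 j, (p k).2 j) ≠ ((p k').1 j, (p k').2 j) := by
    intro k k' hkk'
    by_contra hcon
    push Not at hcon
    exact hkk' (hinj (Prod.ext (Equiv.ext fun j => (Prod.mk.inj (hcon j)).1) (funext fun j => (Prod.mk.inj (hcon j)).2)))
  have hsteps := SingleGauge.card_steps_le (fun j k => ((p k).1 j, (p k).2 j)) hrf hdist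
  -- each column uses at least one incidence, and only present ones
  have hval : ∀ j : Fin m, 1 ≤ (univ.image fun k : Fin (n + 1) => ((p k).1 j, (p k).2 j)).card := fun j =>
    card_pos.mpr ⟨_, mem_image_of_mem _ (mem_univ (0 : Fin (n + 1)))⟩
  have hpres := fun j => card_image_le_card_present d v ε θ p hdom j
  have hsum : ∑ j : Fin m, ((univ.image fun k : Fin (n + 1) => ((p k).1 j, (p k).2 j)).card - 1) + m ≤
      ∑ j : Fin m, (univ.filter fun al : Fin m × Fin K => ε al.1 j al.2 ≠ 0).card := by
    have e : ∑ j : Fin m, ((univ.image fun k : Fin (n + 1) => ((p k).1 j, (p k).2 j)).card - 1) + m =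
        ∑ j : Fin m, (((univ.image fun k : Fin (n + 1) => ((p k).1 j, (p k).2 j)).card - 1) + 1) := by
      rw [sum_add_distrib, sum_const, card_univ, Fintype.card_fin, smul_eq_mul, mul_one]
    rw [e]
    exact sum_le_sum fun j _ => by have := hval j; have := hpres j; omega
  omega

/-- the number of present incidences of a design of format `(m, K)` is at most `m·(m·K)`. [folklore] -/
theorem sum_card_present_le : ∑ j : Fin m, (univ.filter fun al : Fin m × Fin K => ε al.1 j al.2 ≠ 0).card ≤ m * (m * K) := by
  classical
  calc ∑ j : Fin m, (univ.filter fun al : Fin m × Fin K => ε al.1 j al.2 ≠ 0).card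
      ≤ ∑ _j : Fin m, (m * K) := sum_le_sum fun j _ => by
          calc (univ.filter fun al : Fin m × Fin K => ε al.1 j al.2 ≠ 0).card ≤ (univ : Finset (Fin m × Fin K)).card :=
                card_le_card (filter_subset _ _)
            _ = m * K := by rw [card_univ, Fintype.card_prod, Fintype.card_fin, Fintype.card_fin]
    _ = m * (m * K) := by rw [sum_const, card_univ, Fintype.card_fin, smul_eq_mul]

/-- arithmetic: `m·(m·K) ≤ 2^(3(K + ⌊log₂ m⌋²))`. -/
theorem mul_mul_le_two_pow (m K : ℕ) : m * (m * K) ≤ 2 ^ (3 * (K + Nat.log 2 m ^ 2)) := by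
  rcases Nat.eq_zero_or_pos m with rfl | hm
  · simp
  set L := Nat.log 2 m with hL
  have hm2 : m < 2 ^ (L + 1) := hL ▸ Nat.lt_pow_succ_log_self (by norm_num) m
  have hK : K ≤ 2 ^ K := Nat.lt_two_pow_self.le
  rcases Nat.eq_zero_or_pos K with rfl | hKpos
  · simp
  have hL2 : L ≤ L ^ 2 := Nat.le_self_pow two_ne_zero L
  have hLL : 2 * L + 2 + K ≤ 3 * (K + L ^ 2) := by linarith
  calc m * (m * K) ≤ 2 ^ (L + 1) * (2 ^ (L + 1) * 2 ^ K) :=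
        Nat.mul_le_mul hm2.le (Nat.mul_le_mul hm2.le hK)
    _ = 2 ^ (2 * L + 2 + K) := by rw [← pow_add, ← pow_add]; ring_nf
    _ ≤ 2 ^ (3 * (K + L ^ 2)) := Nat.pow_le_pow_right (by norm_num) hLL

/-- **RETURN-FREE CHAINS SATISFY THE INEQUALITY OF `TropicalB` WITH `C = 3`.**  For every design of every format and every sign-alternating
dominant chain at strictly increasing integer slopes (the hypotheses of `TropRootLawAt`) whose columns are return-free:
`n ≤ 2^(3(K + ⌊log₂ m⌋²))`.  A SECTOR statement (the crux quantifies over all chains); by the runs law a chain outside the sector pays for its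
extra length in returns, one per step beyond `m·(m·K) − m`. [this seat] -/
theorem tropicalB_shape_of_returnFree (hθ : StrictMono θ) (hdom : ∀ k, IsDominant d v ε (θ k) (p k))
    (halt : ∀ k : Fin n, termSign ε (p k.castSucc) * termSign ε (p k.succ) < 0)
    (hrf : ∀ (j : Fin m) (k₁ k₂ k₃ : Fin (n + 1)), k₁ < k₂ → k₂ < k₃ →
      ((p k₁).1 j, (p k₁).2 j) = ((p k₃).1 j, (p k₃).2 j) → ((p k₂).1 j, (p k₂).2 j) = ((p k₁).1 j, (p k₁).2 j)) :
    n ≤ 2 ^ (3 * (K + Nat.log 2 m ^ 2)) := by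
  have h1 := chain_le_of_returnFree d v ε θ p hθ hdom halt hrf
  have h2 := sum_card_present_le (m := m) (K := K) ε
  have h3 := mul_mul_le_two_pow m K
  omega

/-- **RETURNS PAY FOR LENGTH.**  For every sign-alternating dominant chain at strictly increasing slopes, with `R := Σ_j (#changes_j + 1 −
#distinct incidences_j)` the total number of returns: `n + m ≤ #present incidences + R`; i.e. every step beyond the return-free budget is a
return of some column to an incidence it had left. [this seat] -/
theorem chain_le_present_add_returns (hdom : ∀ k, IsDominant d v ε (θ k) (p k))
    (halt : ∀ k : Fin n, termSign ε (p k.castSucc) * termSign ε (p k.succ) < 0) :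
    n + m ≤ ∑ j : Fin m, (univ.filter fun al : Fin m × Fin K => ε al.1 j al.2 ≠ 0).card +
      ∑ j : Fin m, ((univ.filter fun k : Fin n =>
          ((p k.castSucc).1 j, (p k.castSucc).2 j) ≠ ((p k.succ).1 j, (p k.succ).2 j)).card + 1 -
        (univ.image fun k : Fin (n + 1) => ((p k).1 j, (p k).2 j)).card) := by
  classical
  have hch := chain_le_sum_card_changes ε p halt
  have hvc : ∀ j : Fin m, (univ.image fun k : Fin (n + 1) => ((p k).1 j, (p k).2 j)).card ≤
      (univ.filter fun k : Fin n => ((p k.castSucc).1 j, (p k.castSucc).2 j) ≠ ((p k.succ).1 j, (p k.succ).2 j)).card + 1 :=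
    fun j => card_image_le_card_changes_succ (fun k : Fin (n + 1) => ((p k).1 j, (p k).2 j))
  have hval : ∀ j : Fin m, 1 ≤ (univ.image fun k : Fin (n + 1) => ((p k).1 j, (p k).2 j)).card := fun j =>
    card_pos.mpr ⟨_, mem_image_of_mem _ (mem_univ (0 : Fin (n + 1)))⟩
  have hpres := fun j => card_image_le_card_present d v ε θ p hdom j
  -- per column: changes_j + 1 ≤ present_j + (changes_j + 1 − values_j) + (values_j − 1) … assemble with `Finset.sum_le_sum`
  have key : ∀ j : Fin m,
      (univ.filter fun k : Fin n => ((p k.castSucc).1 j, (p k.castSucc).2 j) ≠ ((p k.succ).1 j, (p k.succ).2 j)).card + 1 ≤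
        (univ.filter fun al : Fin m × Fin K => ε al.1 j al.2 ≠ 0).card +
          ((univ.filter fun k : Fin n => ((p k.castSucc).1 j, (p k.castSucc).2 j) ≠ ((p k.succ).1 j, (p k.succ).2 j)).card + 1 -
            (univ.image fun k : Fin (n + 1) => ((p k).1 j, (p k).2 j)).card) := by
    intro j; have := hvc j; have := hval j; have := hpres j; omega
  have hsum := sum_le_sum fun j (_ : j ∈ (univ : Finset (Fin m))) => key j
  rw [sum_add_distrib, sum_add_distrib, sum_const, card_univ, Fintype.card_fin, smul_eq_mul, mul_one] at hsum
  omega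

end Chain

end Returns

end Summit.ValiantsHypothesis.ValiantsHypothesis.Theorems.KPlusLogSqLaw
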